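import Mathlib
import Literature.NumberTheory.LFunctions.Zhang2022.Section17U021ChiR1RelEdge
import HarnessLib

/-!
# Zhang (2022) §17.u021 (χ-reading), remainder `R₁` (terms `m₂ ≥ 2`): the ASSEMBLY SKELETON of the
# relative estimate `R1Rel` from its three range pieces (small arguments · large composite · large prime)

Topic `Literature/NumberTheory/LFunctions/Zhang2022` (Landau–Siegel audit tree; verdict-neutral).
Y. Zhang, *Discrete mean estimates and the Landau–Siegel zero*, arXiv:2211.02515v1 (2022)
[Zhang2022LandauSiegel] — **an unrefereed manuscript under adjudication; nothing here asserts or denies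
its Theorems 1–2, and no claim about Landau–Siegel zeros is made.** Lane ZHANG-L, WP16, leaf h17_9
(`Typed.Section17.Eq17_9RelE e1ppD c′`), sub-leaf `R₁` of `Typed.Section17.Step17_u021Chi` in the
relative currency of record («R1Rel c′», node text countersigned zl-w16-plan W16-S5f 2026-08-27T02:17Z =
hypothesis `hR₁` of `Phi3Eval.step17_u024ChiRelE_of_R1Rel`, `Section17U021ChiR1RelEdge`). §17 p. 98,
tex L4825: "we can drop the terms with `m₂ > 1` … with an acceptable error" (no bound in print).

`R₁ = Σ_{l<D⁴}(ν(l)/l)Σ_{l=q₁q₂}Σ'_{m₁}Σ'_{m₂≥2,(m₂,q₁)=1} b(q₁m₁)χ(q₁m₁)ν₁*(q₂m₂)κ̄₂(m₁m₂)/(m₁m₂)`. This file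
is the OWNER'S SKELETON (ZHANG-L cut 2026-08-27T02:29Z/02:31Z): it bounds `‖R₁‖` by the sum of the
NORMS of the summands (`|χ| ≤ 1`) and splits the `m₂`-range into the three pieces the R₁ hands prove,
each spelled INLINE as a hypothesis in exactly the shape they file (no definition, R1):

* SMALL arguments `q₂m₂ ≤ D⁴` (hypothesis `hS`, relative `ε(𝔞+1)`; assembled from zl-w10-p5's Case-A
  lemma `Typed.Section17.caseA_small_sum_le` p487483, the Case-B twin and the 𝔞-currency outer counts in
  the companion small-part assembly);
* LARGE arguments, COMPOSITE `m₂` (hypothesis `hLc`, absolute `ε`, (A)-free; zl-w14-p2);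
* LARGE arguments, PRIME `m₂` (hypothesis `hLp`, relative; zl-closer-1 (the `T²`-window) + zl-w16-p3
  (bulk, Lemma 3.1 defects)).

PROVED here (theorems only): `norm_R1_summand_le_split` (pointwise: the normed summand is at most the
sum of the three range-restricted non-negative majorants), `tsum_tsum_eq_sum_sum_of_vanish` (finitely
supported double series are finite double sums), and **`step17_u021Chi_R1Rel_of_split :
hS → hLc → hLp → R1Rel c′`**. The closer of record `Phi3Eval.step17_u021Chi_R1Rel_holds` is then the
5-line composition once the three pieces land. WHAT THIS IS NOT: a proof of any of the three pieces.

## References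

* Y. Zhang, arXiv:2211.02515v1 (2022), §17 p. 98 (u020–u021), tex L4821–L4827.
  [cite: Zhang2022LandauSiegel, §17 u021 p.98]
-/

noncomputable section

open Complex Real Finset
open Literature.NumberTheory.LFunctions.Zhang2022.Skeleton
open Literature.NumberTheory.LFunctions.Zhang2022.Typed.Section17

namespace Literature.NumberTheory.LFunctions.Zhang2022.Phi3Eval

/-! ## §1. Finitely supported double series -/

/-- A double series whose terms vanish once either index is `≥ N` is the finite double sum over
`range N × range N`. [folklore] -/
private theorem tsum_tsum_eq_sum_sum_of_vanish {E : Type*} [NormedAddCommGroup E] [NormedSpace ℝ E]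
    [CompleteSpace E] (F : ℕ → ℕ → E) (N : ℕ)
    (h₁ : ∀ m₁ m₂, N ≤ m₁ → F m₁ m₂ = 0) (h₂ : ∀ m₁ m₂, N ≤ m₂ → F m₁ m₂ = 0) :
    (∑' m₁ : ℕ, ∑' m₂ : ℕ, F m₁ m₂) = ∑ m₁ ∈ Finset.range N, ∑ m₂ ∈ Finset.range N, F m₁ m₂ := by
  have hin : ∀ m₁, (∑' m₂ : ℕ, F m₁ m₂) = ∑ m₂ ∈ Finset.range N, F m₁ m₂ := by
    intro m₁
    refine tsum_eq_sum fun m₂ hm₂ => h₂ m₁ m₂ ?_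
    simpa using hm₂
  rw [tsum_congr hin]
  refine tsum_eq_sum fun m₁ hm₁ => ?_
  have hN : N ≤ m₁ := by simpa using hm₁
  exact Finset.sum_eq_zero fun m₂ _ => h₁ m₁ m₂ hN

/-! ## §2. The pointwise split of the normed summand -/

/-- **Pointwise**: for `W ≥ 0`, the norm of the `R₁`-summand `[2 ≤ m₂ ∧ (m₂,q₁)=1]·T` with `‖T‖ ≤ W` is
at most the sum of the three range-restricted majorants (small `q₂m₂ ≤ D⁴`; large composite; large
prime) — exactly one range applies. [cite: Zhang2022LandauSiegel, §17 u021 p.98] -/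
theorem norm_R1_summand_le_split {T : ℂ} {W X : ℝ} (hW0 : 0 ≤ W) (hTW : ‖T‖ ≤ W) (q₁ q₂ m₂ : ℕ) :
    ‖(if 2 ≤ m₂ ∧ Nat.Coprime m₂ q₁ then T else 0)‖ ≤
      (if (2 ≤ m₂ ∧ Nat.Coprime m₂ q₁) ∧ (q₂ : ℝ) * m₂ ≤ X then W else 0) +
      (if X < (q₂ : ℝ) * m₂ ∧ 2 ≤ m₂ ∧ ¬ m₂.Prime ∧ Nat.Coprime m₂ q₁ then W else 0) +
      (if X < (q₂ : ℝ) * m₂ ∧ m₂.Prime ∧ Nat.Coprime m₂ q₁ then W else 0) := by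
  have h1 : 0 ≤ (if (2 ≤ m₂ ∧ Nat.Coprime m₂ q₁) ∧ (q₂ : ℝ) * m₂ ≤ X then W else 0) := by
    split_ifs <;> simp [hW0]
  have h2 : 0 ≤ (if X < (q₂ : ℝ) * m₂ ∧ 2 ≤ m₂ ∧ ¬ m₂.Prime ∧ Nat.Coprime m₂ q₁ then W else 0) := by
    split_ifs <;> simp [hW0]
  have h3 : 0 ≤ (if X < (q₂ : ℝ) * m₂ ∧ m₂.Prime ∧ Nat.Coprime m₂ q₁ then W else 0) := by
    split_ifs <;> simp [hW0]
  by_cases hP : 2 ≤ m₂ ∧ Nat.Coprime m₂ q₁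
  · have e0 : (if 2 ≤ m₂ ∧ Nat.Coprime m₂ q₁ then T else 0) = T := if_pos hP
    rw [e0]
    rcases le_or_gt ((q₂ : ℝ) * m₂) X with hS | hL
    · have e1 : (if (2 ≤ m₂ ∧ Nat.Coprime m₂ q₁) ∧ (q₂ : ℝ) * m₂ ≤ X then W else 0) = W :=
        if_pos ⟨hP, hS⟩
      rw [e1]; linarith
    · by_cases hpr : m₂.Prime
      · have e3 : (if X < (q₂ : ℝ) * m₂ ∧ m₂.Prime ∧ Nat.Coprime m₂ q₁ then W else 0) = W :=
          if_pos ⟨hL, hpr, hP.2⟩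
        rw [e3]; linarith
      · have e2 : (if X < (q₂ : ℝ) * m₂ ∧ 2 ≤ m₂ ∧ ¬ m₂.Prime ∧ Nat.Coprime m₂ q₁ then W else 0) =
            W := if_pos ⟨hL, hP.1, hpr, hP.2⟩
        rw [e2]; linarith
  · have e0 : (if 2 ≤ m₂ ∧ Nat.Coprime m₂ q₁ then T else 0) = 0 := if_neg hP
    rw [e0, norm_zero]
    linarith

/-- **The normed summand is at most the norm-product majorant**:
`‖b(q₁m₁)χ(q₁m₁)ν₁*(q₂m₂)κ̄₂(m₁m₂)/(m₁m₂)‖ ≤ ‖b(q₁m₁)‖‖ν₁*(q₂m₂)‖‖κ̄₂(m₁m₂)‖/(m₁m₂)` (`|χ| ≤ 1`).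
[cite: Zhang2022LandauSiegel, §17 u021 p.98] -/
theorem norm_R1_term_le {D : ℕ} [NeZero D] (χ : DirichletCharacter ℂ D) (c' : ℝ)
    (q₁ q₂ m₁ m₂ : ℕ) :
    ‖bcoef D (q₁ * m₁) * χ ((q₁ * m₁ : ℕ) : ZMod D) * nuOneStar c' χ (q₂ * m₂) *
        kappa2bar c' D (m₁ * m₂) / ((m₁ : ℂ) * m₂)‖ ≤
      ‖bcoef D (q₁ * m₁)‖ * ‖nuOneStar c' χ (q₂ * m₂)‖ * ‖kappa2bar c' D (m₁ * m₂)‖ /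
        ((m₁ : ℝ) * m₂) := by
  rw [norm_div, norm_mul, norm_mul, norm_mul]
  have hden : ‖((m₁ : ℂ) * m₂)‖ = (m₁ : ℝ) * m₂ := by
    rw [norm_mul, Complex.norm_natCast, Complex.norm_natCast]
  rw [hden]
  have hχ : ‖χ ((q₁ * m₁ : ℕ) : ZMod D)‖ ≤ 1 := χ.norm_le_one _
  have h0 : 0 ≤ (m₁ : ℝ) * m₂ := by positivity
  apply div_le_div_of_nonneg_right _ h0
  have hb := norm_nonneg (bcoef D (q₁ * m₁))
  have hν := norm_nonneg (nuOneStar c' χ (q₂ * m₂))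
  have hκ := norm_nonneg (kappa2bar c' D (m₁ * m₂))
  calc ‖bcoef D (q₁ * m₁)‖ * ‖χ ((q₁ * m₁ : ℕ) : ZMod D)‖ * ‖nuOneStar c' χ (q₂ * m₂)‖ *
        ‖kappa2bar c' D (m₁ * m₂)‖
      ≤ ‖bcoef D (q₁ * m₁)‖ * 1 * ‖nuOneStar c' χ (q₂ * m₂)‖ * ‖kappa2bar c' D (m₁ * m₂)‖ := by
        gcongr
    _ = _ := by ring

/-! ## §3. Supports -/

/-- A common index beyond which the `m₁`- and `m₂`-summands of `R₁` vanish: `b(q₁m₁) = 0` for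
`m₁ ≥ N` and `ν₁*(q₂m₂) = 0` for `m₂ ≥ N` whenever `q₁, q₂ ≥ 1` ((15.2) and the support of `ν₁*`).
[cite: Zhang2022LandauSiegel, §15 (15.2); §17 p.98] -/
theorem exists_R1_support {D : ℕ} [NeZero D] (χ : DirichletCharacter ℂ D) (c' : ℝ) :
    ∃ N : ℕ, (∀ q₁ m : ℕ, 1 ≤ q₁ → N ≤ m → bcoef D (q₁ * m) = 0) ∧
      (∀ q₂ m : ℕ, 1 ≤ q₂ → N ≤ m → nuOneStar c' χ (q₂ * m) = 0) := by
  refine ⟨max ⌈bigP D ^ (1 / 2 : ℝ) * max (Skeleton.P2 D) (Skeleton.P3 D)⌉₊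
    ⌈4 * ((D : ℝ) ^ 4 + 1) * bigT D ^ 4⌉₊, fun q₁ m hq hm => ?_, fun q₂ m hq hm => ?_⟩
  · apply bcoef_eq_zero_of_sqrtP_mul_max_le
    have h1 : (⌈bigP D ^ (1 / 2 : ℝ) * max (Skeleton.P2 D) (Skeleton.P3 D)⌉₊ : ℝ) ≤ m := by
      exact_mod_cast le_trans (le_max_left _ _) hm
    have h2 : (m : ℝ) ≤ ((q₁ * m : ℕ) : ℝ) := by
      exact_mod_cast Nat.le_mul_of_pos_left m hq
    exact le_trans (le_trans (Nat.le_ceil _) h1) h2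
  · apply nuOneStar_eq_zero_of_le
    have h1 : (⌈4 * ((D : ℝ) ^ 4 + 1) * bigT D ^ 4⌉₊ : ℝ) ≤ m := by
      exact_mod_cast le_trans (le_max_right _ _) hm
    have h2 : (m : ℝ) ≤ ((q₂ * m : ℕ) : ℝ) := by
      exact_mod_cast Nat.le_mul_of_pos_left m hq
    exact le_trans (le_trans (Nat.le_ceil _) h1) h2

/-! ## §4. The skeleton: `R1Rel` from the three range pieces -/

/-- **R₁ ASSEMBLY SKELETON — `R1Rel c′` from its three range pieces** (ZHANG-L cut of record,
2026-08-27T02:31Z). With the non-negative majorant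
`W(q,m₁,m₂) = ‖b(q₁m₁)‖·‖ν₁*(q₂m₂)‖·‖κ̄₂(m₁m₂)‖/(m₁m₂)` of the normed summand:
`hS` (SMALL arguments `q₂m₂ ≤ D⁴`, relative `ε(𝔞+1)`), `hLc` (LARGE arguments, composite `m₂ ≥ 2`,
absolute), `hLp` (LARGE arguments, prime `m₂`, relative) — each the full `(l, q, m₁, m₂)`-sum of `W`
restricted to its range, spelled inline — imply
`‖R₁‖ ≤ ε(𝔞+1)` eventually, i.e. the node «R1Rel c′» (hypothesis `hR₁` of
`step17_u024ChiRelE_of_R1Rel`, VERBATIM). Proof: `|χ| ≤ 1`, the triangle inequality through the finitely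
supported double series, and the pointwise range split `norm_R1_summand_le_split`.
[cite: Zhang2022LandauSiegel, §17 u021 p.98] -/
theorem step17_u021Chi_R1Rel_of_split (c' : ℝ)
    (hS : ∀ ε : ℝ, 0 < ε → ForAllLarge fun D _ χ => AssumptionA D χ →
      (∑ l ∈ Finset.Ico 1 (D ^ 4), ‖nu χ l‖ / l *
          ∑ q ∈ l.divisorsAntidiagonal, ∑' m₁ : ℕ, ∑' m₂ : ℕ,
            if (2 ≤ m₂ ∧ Nat.Coprime m₂ q.1) ∧ (q.2 : ℝ) * m₂ ≤ (D : ℝ) ^ 4 then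
              ‖bcoef D (q.1 * m₁)‖ * ‖nuOneStar c' χ (q.2 * m₂)‖ * ‖kappa2bar c' D (m₁ * m₂)‖ /
                ((m₁ : ℝ) * m₂)
            else 0) ≤ ε * (frakA χ + 1))
    (hLc : ∀ ε : ℝ, 0 < ε → ForAllLarge fun D _ χ =>
      (∑ l ∈ Finset.Ico 1 (D ^ 4), ‖nu χ l‖ / l *
          ∑ q ∈ l.divisorsAntidiagonal, ∑' m₁ : ℕ, ∑' m₂ : ℕ,
            if (D : ℝ) ^ 4 < (q.2 : ℝ) * m₂ ∧ 2 ≤ m₂ ∧ ¬ m₂.Prime ∧ Nat.Coprime m₂ q.1 then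
              ‖bcoef D (q.1 * m₁)‖ * ‖nuOneStar c' χ (q.2 * m₂)‖ * ‖kappa2bar c' D (m₁ * m₂)‖ /
                ((m₁ : ℝ) * m₂)
            else 0) ≤ ε)
    (hLp : ∀ ε : ℝ, 0 < ε → ForAllLarge fun D _ χ => AssumptionA D χ →
      (∑ l ∈ Finset.Ico 1 (D ^ 4), ‖nu χ l‖ / l *
          ∑ q ∈ l.divisorsAntidiagonal, ∑' m₁ : ℕ, ∑' m₂ : ℕ,
            if (D : ℝ) ^ 4 < (q.2 : ℝ) * m₂ ∧ m₂.Prime ∧ Nat.Coprime m₂ q.1 then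
              ‖bcoef D (q.1 * m₁)‖ * ‖nuOneStar c' χ (q.2 * m₂)‖ * ‖kappa2bar c' D (m₁ * m₂)‖ /
                ((m₁ : ℝ) * m₂)
            else 0) ≤ ε * (frakA χ + 1)) :
    ∀ ε : ℝ, 0 < ε → ForAllLarge fun D _ χ => AssumptionA D χ →
      ‖∑ l ∈ Finset.Ico 1 (D ^ 4), nu χ l / (l : ℂ) *
          ∑ q ∈ l.divisorsAntidiagonal, ∑' m₁ : ℕ, ∑' m₂ : ℕ,
            if 2 ≤ m₂ ∧ Nat.Coprime m₂ q.1 then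
              bcoef D (q.1 * m₁) * χ ((q.1 * m₁ : ℕ) : ZMod D) * nuOneStar c' χ (q.2 * m₂) *
                kappa2bar c' D (m₁ * m₂) / ((m₁ : ℂ) * m₂)
            else 0‖ ≤ ε * (frakA χ + 1) := by
  intro ε hε
  have hε3 : 0 < ε / 3 := by positivity
  obtain ⟨D₀, h⟩ := ((hS _ hε3).and (hLc _ hε3)).and (hLp _ hε3)
  refine ⟨D₀, fun D _ χ hD hq hp hA => ?_⟩
  obtain ⟨⟨eS, eLc⟩, eLp⟩ := h D χ hD hq hp
  replace eS := eS hA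
  replace eLp := eLp hA
  have hA0 : 0 ≤ frakA χ := frakA_nonneg χ
  -- the support index
  obtain ⟨N, hbN, hνN⟩ := exists_R1_support χ c'
  -- abbreviations for the four summand families
  set T : ℕ × ℕ → ℕ → ℕ → ℂ := fun q m₁ m₂ =>
    bcoef D (q.1 * m₁) * χ ((q.1 * m₁ : ℕ) : ZMod D) * nuOneStar c' χ (q.2 * m₂) *
      kappa2bar c' D (m₁ * m₂) / ((m₁ : ℂ) * m₂) with hT
  set W : ℕ × ℕ → ℕ → ℕ → ℝ := fun q m₁ m₂ =>
    ‖bcoef D (q.1 * m₁)‖ * ‖nuOneStar c' χ (q.2 * m₂)‖ * ‖kappa2bar c' D (m₁ * m₂)‖ /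
      ((m₁ : ℝ) * m₂) with hW
  set F : ℕ × ℕ → ℕ → ℕ → ℂ := fun q m₁ m₂ =>
    if 2 ≤ m₂ ∧ Nat.Coprime m₂ q.1 then T q m₁ m₂ else 0 with hF
  set FS : ℕ × ℕ → ℕ → ℕ → ℝ := fun q m₁ m₂ =>
    if (2 ≤ m₂ ∧ Nat.Coprime m₂ q.1) ∧ (q.2 : ℝ) * m₂ ≤ (D : ℝ) ^ 4 then W q m₁ m₂ else 0 with hFS
  set FLc : ℕ × ℕ → ℕ → ℕ → ℝ := fun q m₁ m₂ =>
    if (D : ℝ) ^ 4 < (q.2 : ℝ) * m₂ ∧ 2 ≤ m₂ ∧ ¬ m₂.Prime ∧ Nat.Coprime m₂ q.1 then W q m₁ m₂ else 0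
    with hFLc
  set FLp : ℕ × ℕ → ℕ → ℕ → ℝ := fun q m₁ m₂ =>
    if (D : ℝ) ^ 4 < (q.2 : ℝ) * m₂ ∧ m₂.Prime ∧ Nat.Coprime m₂ q.1 then W q m₁ m₂ else 0 with hFLp
  -- vanishing beyond the support, for `q ∈ l.divisorsAntidiagonal` (`q₁, q₂ ≥ 1`)
  have hq1 : ∀ {l : ℕ} {q : ℕ × ℕ}, q ∈ l.divisorsAntidiagonal → 1 ≤ q.1 ∧ 1 ≤ q.2 := by
    intro l q hq
    have h' := Nat.mem_divisorsAntidiagonal.1 hq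
    refine ⟨Nat.pos_of_ne_zero fun h0 => h'.2 ?_, Nat.pos_of_ne_zero fun h0 => h'.2 ?_⟩
    · rw [← h'.1, h0, zero_mul]
    · rw [← h'.1, h0, mul_zero]
  have hW0 : ∀ q m₁ m₂, 0 ≤ W q m₁ m₂ := fun q m₁ m₂ => by simp only [hW]; positivity
  have hWvan₁ : ∀ q : ℕ × ℕ, 1 ≤ q.1 → ∀ m₁ m₂, N ≤ m₁ → W q m₁ m₂ = 0 := by
    intro q hq m₁ m₂ hm; simp only [hW]; rw [hbN q.1 m₁ hq hm]; simp
  have hWvan₂ : ∀ q : ℕ × ℕ, 1 ≤ q.2 → ∀ m₁ m₂, N ≤ m₂ → W q m₁ m₂ = 0 := by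
    intro q hq m₁ m₂ hm; simp only [hW]; rw [hνN q.2 m₂ hq hm]; simp
  have hTvan₁ : ∀ q : ℕ × ℕ, 1 ≤ q.1 → ∀ m₁ m₂, N ≤ m₁ → T q m₁ m₂ = 0 := by
    intro q hq m₁ m₂ hm; simp only [hT]; rw [hbN q.1 m₁ hq hm]; simp
  have hTvan₂ : ∀ q : ℕ × ℕ, 1 ≤ q.2 → ∀ m₁ m₂, N ≤ m₂ → T q m₁ m₂ = 0 := by
    intro q hq m₁ m₂ hm; simp only [hT]; rw [hνN q.2 m₂ hq hm]; simp
  -- all four double series are finite double sums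
  have hF_eq : ∀ {l : ℕ} {q : ℕ × ℕ}, q ∈ l.divisorsAntidiagonal →
      (∑' m₁ : ℕ, ∑' m₂ : ℕ, F q m₁ m₂) = ∑ m₁ ∈ range N, ∑ m₂ ∈ range N, F q m₁ m₂ := by
    intro l q hq
    obtain ⟨h1, h2⟩ := hq1 hq
    refine tsum_tsum_eq_sum_sum_of_vanish (F q) N (fun m₁ m₂ hm => ?_) (fun m₁ m₂ hm => ?_)
    · simp only [hF]; rw [hTvan₁ q h1 m₁ m₂ hm]; simp
    · simp only [hF]; rw [hTvan₂ q h2 m₁ m₂ hm]; simp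
  have hG_eq : ∀ (G : ℕ × ℕ → ℕ → ℕ → ℝ), (∀ q m₁ m₂, G q m₁ m₂ = 0 ∨ G q m₁ m₂ = W q m₁ m₂) →
      ∀ {l : ℕ} {q : ℕ × ℕ}, q ∈ l.divisorsAntidiagonal →
        (∑' m₁ : ℕ, ∑' m₂ : ℕ, G q m₁ m₂) = ∑ m₁ ∈ range N, ∑ m₂ ∈ range N, G q m₁ m₂ := by
    intro G hG l q hq
    obtain ⟨h1, h2⟩ := hq1 hq
    refine tsum_tsum_eq_sum_sum_of_vanish (G q) N (fun m₁ m₂ hm => ?_) (fun m₁ m₂ hm => ?_)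
    · rcases hG q m₁ m₂ with h | h
      · exact h
      · rw [h, hWvan₁ q h1 m₁ m₂ hm]
    · rcases hG q m₁ m₂ with h | h
      · exact h
      · rw [h, hWvan₂ q h2 m₁ m₂ hm]
  have hFS_cases : ∀ q m₁ m₂, FS q m₁ m₂ = 0 ∨ FS q m₁ m₂ = W q m₁ m₂ := by
    intro q m₁ m₂; simp only [hFS]; split_ifs <;> simp
  have hFLc_cases : ∀ q m₁ m₂, FLc q m₁ m₂ = 0 ∨ FLc q m₁ m₂ = W q m₁ m₂ := by
    intro q m₁ m₂; simp only [hFLc]; split_ifs <;> simp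
  have hFLp_cases : ∀ q m₁ m₂, FLp q m₁ m₂ = 0 ∨ FLp q m₁ m₂ = W q m₁ m₂ := by
    intro q m₁ m₂; simp only [hFLp]; split_ifs <;> simp
  -- the pointwise split
  have hpt : ∀ q m₁ m₂, ‖F q m₁ m₂‖ ≤ FS q m₁ m₂ + FLc q m₁ m₂ + FLp q m₁ m₂ := by
    intro q m₁ m₂
    simp only [hF, hFS, hFLc, hFLp]
    exact norm_R1_summand_le_split (hW0 q m₁ m₂) (norm_R1_term_le χ c' q.1 q.2 m₁ m₂) q.1 q.2 m₂
  -- per `(l, q)`: the norm of the double series is at most the sum of the three piece sums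
  have hlq : ∀ {l : ℕ} {q : ℕ × ℕ}, q ∈ l.divisorsAntidiagonal →
      ‖∑' m₁ : ℕ, ∑' m₂ : ℕ, F q m₁ m₂‖ ≤
        (∑' m₁ : ℕ, ∑' m₂ : ℕ, FS q m₁ m₂) + (∑' m₁ : ℕ, ∑' m₂ : ℕ, FLc q m₁ m₂) +
          (∑' m₁ : ℕ, ∑' m₂ : ℕ, FLp q m₁ m₂) := by
    intro l q hq
    rw [hF_eq hq, hG_eq FS hFS_cases hq, hG_eq FLc hFLc_cases hq, hG_eq FLp hFLp_cases hq,
      ← Finset.sum_add_distrib, ← Finset.sum_add_distrib]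
    refine (norm_sum_le _ _).trans (Finset.sum_le_sum fun m₁ _ => ?_)
    rw [← Finset.sum_add_distrib, ← Finset.sum_add_distrib]
    exact (norm_sum_le _ _).trans (Finset.sum_le_sum fun m₂ _ => hpt q m₁ m₂)
  -- per `l`: sum over `q`
  have hl : ∀ l ∈ Finset.Ico 1 (D ^ 4),
      ‖nu χ l / (l : ℂ) * ∑ q ∈ l.divisorsAntidiagonal, ∑' m₁ : ℕ, ∑' m₂ : ℕ, F q m₁ m₂‖ ≤
        ‖nu χ l‖ / l * ∑ q ∈ l.divisorsAntidiagonal, (∑' m₁ : ℕ, ∑' m₂ : ℕ, FS q m₁ m₂) +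
        ‖nu χ l‖ / l * ∑ q ∈ l.divisorsAntidiagonal, (∑' m₁ : ℕ, ∑' m₂ : ℕ, FLc q m₁ m₂) +
        ‖nu χ l‖ / l * ∑ q ∈ l.divisorsAntidiagonal, (∑' m₁ : ℕ, ∑' m₂ : ℕ, FLp q m₁ m₂) := by
    intro l hl
    rw [norm_mul, norm_div, Complex.norm_natCast, ← mul_add, ← mul_add, ← Finset.sum_add_distrib,
      ← Finset.sum_add_distrib]
    refine mul_le_mul_of_nonneg_left ((norm_sum_le _ _).trans (Finset.sum_le_sum fun q hq => hlq hq))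
      (by positivity)
  -- assemble
  calc ‖∑ l ∈ Finset.Ico 1 (D ^ 4), nu χ l / (l : ℂ) *
          ∑ q ∈ l.divisorsAntidiagonal, ∑' m₁ : ℕ, ∑' m₂ : ℕ, F q m₁ m₂‖
      ≤ ∑ l ∈ Finset.Ico 1 (D ^ 4), ‖nu χ l / (l : ℂ) *
          ∑ q ∈ l.divisorsAntidiagonal, ∑' m₁ : ℕ, ∑' m₂ : ℕ, F q m₁ m₂‖ := norm_sum_le _ _
    _ ≤ ∑ l ∈ Finset.Ico 1 (D ^ 4),
          (‖nu χ l‖ / l * ∑ q ∈ l.divisorsAntidiagonal, (∑' m₁ : ℕ, ∑' m₂ : ℕ, FS q m₁ m₂) +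
          ‖nu χ l‖ / l * ∑ q ∈ l.divisorsAntidiagonal, (∑' m₁ : ℕ, ∑' m₂ : ℕ, FLc q m₁ m₂) +
          ‖nu χ l‖ / l * ∑ q ∈ l.divisorsAntidiagonal, (∑' m₁ : ℕ, ∑' m₂ : ℕ, FLp q m₁ m₂)) :=
        Finset.sum_le_sum hl
    _ = (∑ l ∈ Finset.Ico 1 (D ^ 4), ‖nu χ l‖ / l *
            ∑ q ∈ l.divisorsAntidiagonal, (∑' m₁ : ℕ, ∑' m₂ : ℕ, FS q m₁ m₂)) +
        (∑ l ∈ Finset.Ico 1 (D ^ 4), ‖nu χ l‖ / l *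
            ∑ q ∈ l.divisorsAntidiagonal, (∑' m₁ : ℕ, ∑' m₂ : ℕ, FLc q m₁ m₂)) +
        (∑ l ∈ Finset.Ico 1 (D ^ 4), ‖nu χ l‖ / l *
            ∑ q ∈ l.divisorsAntidiagonal, (∑' m₁ : ℕ, ∑' m₂ : ℕ, FLp q m₁ m₂)) := by
        rw [Finset.sum_add_distrib, Finset.sum_add_distrib]
    _ ≤ ε / 3 * (frakA χ + 1) + ε / 3 + ε / 3 * (frakA χ + 1) := add_le_add (add_le_add eS eLc) eLp
    _ ≤ ε * (frakA χ + 1) := by nlinarith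

/-- **R₁ ASSEMBLY SKELETON, RELATIVE composite piece** (ruling W16-S5f part 2 (B) / planner FLAG
2026-08-27T02:43Z): the same composition as `step17_u021Chi_R1Rel_of_split` with `hLc` (LARGE
arguments, composite `m₂`) in the RELATIVE currency `AssumptionA D χ → … ≤ ε(𝔞+1)` — the shape of
zl-w14-p2's final statement; three relative thirds add up to `ε(𝔞+1)`. The absolute-`hLc` theorem
above is the stronger-hypothesis corollary. [cite: Zhang2022LandauSiegel, §17 u021 p.98] -/
theorem step17_u021Chi_R1Rel_of_split_rel (c' : ℝ)
    (hS : ∀ ε : ℝ, 0 < ε → ForAllLarge fun D _ χ => AssumptionA D χ →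
      (∑ l ∈ Finset.Ico 1 (D ^ 4), ‖nu χ l‖ / l *
          ∑ q ∈ l.divisorsAntidiagonal, ∑' m₁ : ℕ, ∑' m₂ : ℕ,
            if (2 ≤ m₂ ∧ Nat.Coprime m₂ q.1) ∧ (q.2 : ℝ) * m₂ ≤ (D : ℝ) ^ 4 then
              ‖bcoef D (q.1 * m₁)‖ * ‖nuOneStar c' χ (q.2 * m₂)‖ * ‖kappa2bar c' D (m₁ * m₂)‖ /
                ((m₁ : ℝ) * m₂)
            else 0) ≤ ε * (frakA χ + 1))
    (hLc : ∀ ε : ℝ, 0 < ε → ForAllLarge fun D _ χ => AssumptionA D χ →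
      (∑ l ∈ Finset.Ico 1 (D ^ 4), ‖nu χ l‖ / l *
          ∑ q ∈ l.divisorsAntidiagonal, ∑' m₁ : ℕ, ∑' m₂ : ℕ,
            if (D : ℝ) ^ 4 < (q.2 : ℝ) * m₂ ∧ 2 ≤ m₂ ∧ ¬ m₂.Prime ∧ Nat.Coprime m₂ q.1 then
              ‖bcoef D (q.1 * m₁)‖ * ‖nuOneStar c' χ (q.2 * m₂)‖ * ‖kappa2bar c' D (m₁ * m₂)‖ /
                ((m₁ : ℝ) * m₂)
            else 0) ≤ ε * (frakA χ + 1))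
    (hLp : ∀ ε : ℝ, 0 < ε → ForAllLarge fun D _ χ => AssumptionA D χ →
      (∑ l ∈ Finset.Ico 1 (D ^ 4), ‖nu χ l‖ / l *
          ∑ q ∈ l.divisorsAntidiagonal, ∑' m₁ : ℕ, ∑' m₂ : ℕ,
            if (D : ℝ) ^ 4 < (q.2 : ℝ) * m₂ ∧ m₂.Prime ∧ Nat.Coprime m₂ q.1 then
              ‖bcoef D (q.1 * m₁)‖ * ‖nuOneStar c' χ (q.2 * m₂)‖ * ‖kappa2bar c' D (m₁ * m₂)‖ /
                ((m₁ : ℝ) * m₂)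
            else 0) ≤ ε * (frakA χ + 1)) :
    ∀ ε : ℝ, 0 < ε → ForAllLarge fun D _ χ => AssumptionA D χ →
      ‖∑ l ∈ Finset.Ico 1 (D ^ 4), nu χ l / (l : ℂ) *
          ∑ q ∈ l.divisorsAntidiagonal, ∑' m₁ : ℕ, ∑' m₂ : ℕ,
            if 2 ≤ m₂ ∧ Nat.Coprime m₂ q.1 then
              bcoef D (q.1 * m₁) * χ ((q.1 * m₁ : ℕ) : ZMod D) * nuOneStar c' χ (q.2 * m₂) *
                kappa2bar c' D (m₁ * m₂) / ((m₁ : ℂ) * m₂)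
            else 0‖ ≤ ε * (frakA χ + 1) := by
  intro ε hε
  have hε3 : 0 < ε / 3 := by positivity
  obtain ⟨D₀, h⟩ := ((hS _ hε3).and (hLc _ hε3)).and (hLp _ hε3)
  refine ⟨D₀, fun D _ χ hD hq hp hA => ?_⟩
  obtain ⟨⟨eS, eLc⟩, eLp⟩ := h D χ hD hq hp
  replace eS := eS hA
  replace eLc := eLc hA
  replace eLp := eLp hA
  have hA0 : 0 ≤ frakA χ := frakA_nonneg χ
  -- the support index
  obtain ⟨N, hbN, hνN⟩ := exists_R1_support χ c'
  -- abbreviations for the four summand families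
  set T : ℕ × ℕ → ℕ → ℕ → ℂ := fun q m₁ m₂ =>
    bcoef D (q.1 * m₁) * χ ((q.1 * m₁ : ℕ) : ZMod D) * nuOneStar c' χ (q.2 * m₂) *
      kappa2bar c' D (m₁ * m₂) / ((m₁ : ℂ) * m₂) with hT
  set W : ℕ × ℕ → ℕ → ℕ → ℝ := fun q m₁ m₂ =>
    ‖bcoef D (q.1 * m₁)‖ * ‖nuOneStar c' χ (q.2 * m₂)‖ * ‖kappa2bar c' D (m₁ * m₂)‖ /
      ((m₁ : ℝ) * m₂) with hW
  set F : ℕ × ℕ → ℕ → ℕ → ℂ := fun q m₁ m₂ =>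
    if 2 ≤ m₂ ∧ Nat.Coprime m₂ q.1 then T q m₁ m₂ else 0 with hF
  set FS : ℕ × ℕ → ℕ → ℕ → ℝ := fun q m₁ m₂ =>
    if (2 ≤ m₂ ∧ Nat.Coprime m₂ q.1) ∧ (q.2 : ℝ) * m₂ ≤ (D : ℝ) ^ 4 then W q m₁ m₂ else 0 with hFS
  set FLc : ℕ × ℕ → ℕ → ℕ → ℝ := fun q m₁ m₂ =>
    if (D : ℝ) ^ 4 < (q.2 : ℝ) * m₂ ∧ 2 ≤ m₂ ∧ ¬ m₂.Prime ∧ Nat.Coprime m₂ q.1 then W q m₁ m₂ else 0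
    with hFLc
  set FLp : ℕ × ℕ → ℕ → ℕ → ℝ := fun q m₁ m₂ =>
    if (D : ℝ) ^ 4 < (q.2 : ℝ) * m₂ ∧ m₂.Prime ∧ Nat.Coprime m₂ q.1 then W q m₁ m₂ else 0 with hFLp
  -- vanishing beyond the support, for `q ∈ l.divisorsAntidiagonal` (`q₁, q₂ ≥ 1`)
  have hq1 : ∀ {l : ℕ} {q : ℕ × ℕ}, q ∈ l.divisorsAntidiagonal → 1 ≤ q.1 ∧ 1 ≤ q.2 := by
    intro l q hq
    have h' := Nat.mem_divisorsAntidiagonal.1 hq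
    refine ⟨Nat.pos_of_ne_zero fun h0 => h'.2 ?_, Nat.pos_of_ne_zero fun h0 => h'.2 ?_⟩
    · rw [← h'.1, h0, zero_mul]
    · rw [← h'.1, h0, mul_zero]
  have hW0 : ∀ q m₁ m₂, 0 ≤ W q m₁ m₂ := fun q m₁ m₂ => by simp only [hW]; positivity
  have hWvan₁ : ∀ q : ℕ × ℕ, 1 ≤ q.1 → ∀ m₁ m₂, N ≤ m₁ → W q m₁ m₂ = 0 := by
    intro q hq m₁ m₂ hm; simp only [hW]; rw [hbN q.1 m₁ hq hm]; simp
  have hWvan₂ : ∀ q : ℕ × ℕ, 1 ≤ q.2 → ∀ m₁ m₂, N ≤ m₂ → W q m₁ m₂ = 0 := by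
    intro q hq m₁ m₂ hm; simp only [hW]; rw [hνN q.2 m₂ hq hm]; simp
  have hTvan₁ : ∀ q : ℕ × ℕ, 1 ≤ q.1 → ∀ m₁ m₂, N ≤ m₁ → T q m₁ m₂ = 0 := by
    intro q hq m₁ m₂ hm; simp only [hT]; rw [hbN q.1 m₁ hq hm]; simp
  have hTvan₂ : ∀ q : ℕ × ℕ, 1 ≤ q.2 → ∀ m₁ m₂, N ≤ m₂ → T q m₁ m₂ = 0 := by
    intro q hq m₁ m₂ hm; simp only [hT]; rw [hνN q.2 m₂ hq hm]; simp
  -- all four double series are finite double sums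
  have hF_eq : ∀ {l : ℕ} {q : ℕ × ℕ}, q ∈ l.divisorsAntidiagonal →
      (∑' m₁ : ℕ, ∑' m₂ : ℕ, F q m₁ m₂) = ∑ m₁ ∈ range N, ∑ m₂ ∈ range N, F q m₁ m₂ := by
    intro l q hq
    obtain ⟨h1, h2⟩ := hq1 hq
    refine tsum_tsum_eq_sum_sum_of_vanish (F q) N (fun m₁ m₂ hm => ?_) (fun m₁ m₂ hm => ?_)
    · simp only [hF]; rw [hTvan₁ q h1 m₁ m₂ hm]; simp
    · simp only [hF]; rw [hTvan₂ q h2 m₁ m₂ hm]; simp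
  have hG_eq : ∀ (G : ℕ × ℕ → ℕ → ℕ → ℝ), (∀ q m₁ m₂, G q m₁ m₂ = 0 ∨ G q m₁ m₂ = W q m₁ m₂) →
      ∀ {l : ℕ} {q : ℕ × ℕ}, q ∈ l.divisorsAntidiagonal →
        (∑' m₁ : ℕ, ∑' m₂ : ℕ, G q m₁ m₂) = ∑ m₁ ∈ range N, ∑ m₂ ∈ range N, G q m₁ m₂ := by
    intro G hG l q hq
    obtain ⟨h1, h2⟩ := hq1 hq
    refine tsum_tsum_eq_sum_sum_of_vanish (G q) N (fun m₁ m₂ hm => ?_) (fun m₁ m₂ hm => ?_)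
    · rcases hG q m₁ m₂ with h | h
      · exact h
      · rw [h, hWvan₁ q h1 m₁ m₂ hm]
    · rcases hG q m₁ m₂ with h | h
      · exact h
      · rw [h, hWvan₂ q h2 m₁ m₂ hm]
  have hFS_cases : ∀ q m₁ m₂, FS q m₁ m₂ = 0 ∨ FS q m₁ m₂ = W q m₁ m₂ := by
    intro q m₁ m₂; simp only [hFS]; split_ifs <;> simp
  have hFLc_cases : ∀ q m₁ m₂, FLc q m₁ m₂ = 0 ∨ FLc q m₁ m₂ = W q m₁ m₂ := by
    intro q m₁ m₂; simp only [hFLc]; split_ifs <;> simp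
  have hFLp_cases : ∀ q m₁ m₂, FLp q m₁ m₂ = 0 ∨ FLp q m₁ m₂ = W q m₁ m₂ := by
    intro q m₁ m₂; simp only [hFLp]; split_ifs <;> simp
  -- the pointwise split
  have hpt : ∀ q m₁ m₂, ‖F q m₁ m₂‖ ≤ FS q m₁ m₂ + FLc q m₁ m₂ + FLp q m₁ m₂ := by
    intro q m₁ m₂
    simp only [hF, hFS, hFLc, hFLp]
    exact norm_R1_summand_le_split (hW0 q m₁ m₂) (norm_R1_term_le χ c' q.1 q.2 m₁ m₂) q.1 q.2 m₂
  -- per `(l, q)`: the norm of the double series is at most the sum of the three piece sums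
  have hlq : ∀ {l : ℕ} {q : ℕ × ℕ}, q ∈ l.divisorsAntidiagonal →
      ‖∑' m₁ : ℕ, ∑' m₂ : ℕ, F q m₁ m₂‖ ≤
        (∑' m₁ : ℕ, ∑' m₂ : ℕ, FS q m₁ m₂) + (∑' m₁ : ℕ, ∑' m₂ : ℕ, FLc q m₁ m₂) +
          (∑' m₁ : ℕ, ∑' m₂ : ℕ, FLp q m₁ m₂) := by
    intro l q hq
    rw [hF_eq hq, hG_eq FS hFS_cases hq, hG_eq FLc hFLc_cases hq, hG_eq FLp hFLp_cases hq,
      ← Finset.sum_add_distrib, ← Finset.sum_add_distrib]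
    refine (norm_sum_le _ _).trans (Finset.sum_le_sum fun m₁ _ => ?_)
    rw [← Finset.sum_add_distrib, ← Finset.sum_add_distrib]
    exact (norm_sum_le _ _).trans (Finset.sum_le_sum fun m₂ _ => hpt q m₁ m₂)
  -- per `l`: sum over `q`
  have hl : ∀ l ∈ Finset.Ico 1 (D ^ 4),
      ‖nu χ l / (l : ℂ) * ∑ q ∈ l.divisorsAntidiagonal, ∑' m₁ : ℕ, ∑' m₂ : ℕ, F q m₁ m₂‖ ≤
        ‖nu χ l‖ / l * ∑ q ∈ l.divisorsAntidiagonal, (∑' m₁ : ℕ, ∑' m₂ : ℕ, FS q m₁ m₂) +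
        ‖nu χ l‖ / l * ∑ q ∈ l.divisorsAntidiagonal, (∑' m₁ : ℕ, ∑' m₂ : ℕ, FLc q m₁ m₂) +
        ‖nu χ l‖ / l * ∑ q ∈ l.divisorsAntidiagonal, (∑' m₁ : ℕ, ∑' m₂ : ℕ, FLp q m₁ m₂) := by
    intro l hl
    rw [norm_mul, norm_div, Complex.norm_natCast, ← mul_add, ← mul_add, ← Finset.sum_add_distrib,
      ← Finset.sum_add_distrib]
    refine mul_le_mul_of_nonneg_left ((norm_sum_le _ _).trans (Finset.sum_le_sum fun q hq => hlq hq))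
      (by positivity)
  -- assemble
  calc ‖∑ l ∈ Finset.Ico 1 (D ^ 4), nu χ l / (l : ℂ) *
          ∑ q ∈ l.divisorsAntidiagonal, ∑' m₁ : ℕ, ∑' m₂ : ℕ, F q m₁ m₂‖
      ≤ ∑ l ∈ Finset.Ico 1 (D ^ 4), ‖nu χ l / (l : ℂ) *
          ∑ q ∈ l.divisorsAntidiagonal, ∑' m₁ : ℕ, ∑' m₂ : ℕ, F q m₁ m₂‖ := norm_sum_le _ _
    _ ≤ ∑ l ∈ Finset.Ico 1 (D ^ 4),
          (‖nu χ l‖ / l * ∑ q ∈ l.divisorsAntidiagonal, (∑' m₁ : ℕ, ∑' m₂ : ℕ, FS q m₁ m₂) +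
          ‖nu χ l‖ / l * ∑ q ∈ l.divisorsAntidiagonal, (∑' m₁ : ℕ, ∑' m₂ : ℕ, FLc q m₁ m₂) +
          ‖nu χ l‖ / l * ∑ q ∈ l.divisorsAntidiagonal, (∑' m₁ : ℕ, ∑' m₂ : ℕ, FLp q m₁ m₂)) :=
        Finset.sum_le_sum hl
    _ = (∑ l ∈ Finset.Ico 1 (D ^ 4), ‖nu χ l‖ / l *
            ∑ q ∈ l.divisorsAntidiagonal, (∑' m₁ : ℕ, ∑' m₂ : ℕ, FS q m₁ m₂)) +
        (∑ l ∈ Finset.Ico 1 (D ^ 4), ‖nu χ l‖ / l *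
            ∑ q ∈ l.divisorsAntidiagonal, (∑' m₁ : ℕ, ∑' m₂ : ℕ, FLc q m₁ m₂)) +
        (∑ l ∈ Finset.Ico 1 (D ^ 4), ‖nu χ l‖ / l *
            ∑ q ∈ l.divisorsAntidiagonal, (∑' m₁ : ℕ, ∑' m₂ : ℕ, FLp q m₁ m₂)) := by
        rw [Finset.sum_add_distrib, Finset.sum_add_distrib]
    _ ≤ ε / 3 * (frakA χ + 1) + ε / 3 * (frakA χ + 1) + ε / 3 * (frakA χ + 1) :=
        add_le_add (add_le_add eS eLc) eLp
    _ = ε * (frakA χ + 1) := by ring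

end Literature.NumberTheory.LFunctions.Zhang2022.Phi3Eval
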